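import Summits.CriticalPhenomena.CardyFormulaZ2.Theorems.CardySusyWardDiscretisationFamilyExistsInnerCells
import Summits.CriticalPhenomena.CardyFormulaZ2.Theorems.CardySusyWardDiscretisationFamilyExistsDegenerate
import HarnessLib

/-!
# Cells, boundary sites and feet in integer coordinates — helper for `DiscretisationFamilyExists` (stmt-CriticalPhenomena-9644)

Bookkeeping for the selection of the cut edge (`…ExistsSelection`), in the coordinates of
`Mesh.cell`: the face with lower-left corner `![k, j]` is "cell `(k, j)`", its corners are
`![k, j], ![k+1, j], ![k, j+1], ![k+1, j+1]`.  For the bare data `E` on a regular open set: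

* corners of `![k, j]` (`isCorner_vec_iff`), the four faces at a site (`faceAt_vec`);
* a site all of whose four cells are inner is not a boundary site (`not_mem_zdBoundary_of_four`);
* the two ends of a side shared by an inner and a non-inner cell are boundary sites
  (`mem_zdBoundary_of_inner_not_inner_{h,v}` and primed versions);
* sides of inner cells are edges of `Ω_δ` (`adj_of_inner_*`);
* a boundary point on an open lattice segment forbids both adjacent cells to be inner
  (`not_both_inner_of_frontier_{h,v}`, from `…ExistsInnerCells`);
* feet of degenerate pairs in coordinates (`farPole_vec_*`).
-/

noncomputable section

open Set Metric Complex
open Literature.Probability.LatticeModels Literature.Probability.Percolation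
  Literature.Probability.LatticeModels.Mesh Literature.Probability.LatticeModels.DiscreteDobrushin

namespace Summit.CriticalPhenomena.CardyFormulaZ2.Theorems.DiscretisationFamilyExists

/-! ### Corners and faces in coordinates -/

/-- The `Bool`-corners of cell `(k, j)` as vectors. [folklore] -/
theorem corner_eq_vec (k j : ℤ) (a b : Bool) :
    corner k j a b = ![k + (if a then 1 else 0), j + (if b then 1 else 0)] := by
  funext i; fin_cases i <;> rfl

/-- **The four corners of cell `(k, j)`.** [folklore] -/
theorem isCorner_vec_iff {v : Site 2} {k j : ℤ} :
    IsCorner v ![k, j] ↔ v = ![k, j] ∨ v = ![k + 1, j] ∨ v = ![k, j + 1] ∨ v = ![k + 1, j + 1] := by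
  constructor
  · intro h
    obtain ⟨a, b, rfl⟩ := exists_corner_eq_of_isCorner h
    cases a <;> cases b
    · left; funext i; fin_cases i <;> simp [corner]
    · right; right; left; funext i; fin_cases i <;> simp [corner]
    · right; left; funext i; fin_cases i <;> simp [corner]
    · right; right; right; funext i; fin_cases i <;> simp [corner]
  · have key : ∀ a b : Bool, IsCorner (corner k j a b) ![k, j] := fun a b => by
      have := isCorner_corner ![k, j] a b
      simpa using this
    rintro (rfl | rfl | rfl | rfl)
    · simpa [corner_eq_vec] using key false false
    · simpa [corner_eq_vec] using key true false
    · simpa [corner_eq_vec] using key false true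
    · simpa [corner_eq_vec] using key true true

/-- The four faces at the site `![a, b]`: `faceAt _ 0 = (a, b)` (NE), `1 = (a-1, b)` (NW),
`2 = (a-1, b-1)` (SW), `3 = (a, b-1)` (SE). [folklore] -/
theorem faceAt_vec (a b : ℤ) :
    faceAt ![a, b] 0 = ![a, b] ∧ faceAt ![a, b] 1 = ![a - 1, b] ∧
      faceAt ![a, b] 2 = ![a - 1, b - 1] ∧ faceAt ![a, b] 3 = ![a, b - 1] := by
  refine ⟨?_, ?_, ?_, ?_⟩ <;> funext i <;> fin_cases i <;> simp [faceAt, cornerOff, sub_eq_add_neg]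

/-- **A site all of whose four cells are inner is not a boundary site.** [folklore] -/
theorem not_mem_zdBoundary_of_four {E : DiscreteDobrushin} (a b : ℤ)
    (h0 : E.IsInnerFace ![a, b]) (h1 : E.IsInnerFace ![a - 1, b])
    (h2 : E.IsInnerFace ![a - 1, b - 1]) (h3 : E.IsInnerFace ![a, b - 1]) :
    (![a, b] : Site 2) ∉ E.zdBoundary := by
  obtain ⟨e0, e1, e2, e3⟩ := faceAt_vec a b
  refine not_mem_zdBoundary_of_forall_isInnerFace fun k => ?_
  fin_cases k
  · show E.IsInnerFace (faceAt ![a, b] 0); rw [e0]; exact h0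
  · show E.IsInnerFace (faceAt ![a, b] 1); rw [e1]; exact h1
  · show E.IsInnerFace (faceAt ![a, b] 2); rw [e2]; exact h2
  · show E.IsInnerFace (faceAt ![a, b] 3); rw [e3]; exact h3

/-! ### Sides of inner cells are edges of `Ω_δ` -/

/-- Lattice adjacency of horizontal neighbours. [folklore] -/
theorem zdGraph_adj_vec_h (k j : ℤ) : (zdGraph 2).Adj ![k, j] ![k + 1, j] := by
  have := zdGraph_adj_corner_horizontal k j false
  simpa [corner_eq_vec] using this

/-- Lattice adjacency of vertical neighbours. [folklore] -/
theorem zdGraph_adj_vec_v (k j : ℤ) : (zdGraph 2).Adj ![k, j] ![k, j + 1] := by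
  have := zdGraph_adj_corner_vertical k j false
  simpa [corner_eq_vec] using this

/-- The bottom side of an inner cell is an edge of `Ω_δ`. [folklore] -/
theorem adj_bottom_of_inner {E : DiscreteDobrushin} {k j : ℤ} (h : E.IsInnerFace ![k, j]) :
    (discreteDomainGraph E.Ω E.δ).Adj ![k, j] ![k + 1, j] :=
  h _ _ (isCorner_vec_iff.2 (Or.inl rfl)) (isCorner_vec_iff.2 (Or.inr (Or.inl rfl))) (zdGraph_adj_vec_h k j)

/-- The top side of an inner cell is an edge of `Ω_δ`. [folklore] -/
theorem adj_top_of_inner {E : DiscreteDobrushin} {k j : ℤ} (h : E.IsInnerFace ![k, j]) :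
    (discreteDomainGraph E.Ω E.δ).Adj ![k, j + 1] ![k + 1, j + 1] :=
  h _ _ (isCorner_vec_iff.2 (Or.inr (Or.inr (Or.inl rfl)))) (isCorner_vec_iff.2 (Or.inr (Or.inr (Or.inr rfl))))
    (zdGraph_adj_vec_h k (j + 1))

/-- The left side of an inner cell is an edge of `Ω_δ`. [folklore] -/
theorem adj_left_of_inner {E : DiscreteDobrushin} {k j : ℤ} (h : E.IsInnerFace ![k, j]) :
    (discreteDomainGraph E.Ω E.δ).Adj ![k, j] ![k, j + 1] :=
  h _ _ (isCorner_vec_iff.2 (Or.inl rfl)) (isCorner_vec_iff.2 (Or.inr (Or.inr (Or.inl rfl)))) (zdGraph_adj_vec_v k j)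

/-- The right side of an inner cell is an edge of `Ω_δ`. [folklore] -/
theorem adj_right_of_inner {E : DiscreteDobrushin} {k j : ℤ} (h : E.IsInnerFace ![k, j]) :
    (discreteDomainGraph E.Ω E.δ).Adj ![k + 1, j] ![k + 1, j + 1] :=
  h _ _ (isCorner_vec_iff.2 (Or.inr (Or.inl rfl))) (isCorner_vec_iff.2 (Or.inr (Or.inr (Or.inr rfl))))
    (zdGraph_adj_vec_v (k + 1) j)

/-! ### Boundary sites from an inner / non-inner pair of cells -/

/-- **Both ends of the side between an inner cell `(k, j)` and a non-inner cell `(k, j-1)` below it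
are boundary sites.** [folklore] -/
theorem mem_zdBoundary_of_inner_not_inner_below {E : DiscreteDobrushin} {k j : ℤ}
    (h : E.IsInnerFace ![k, j]) (h' : ¬ E.IsInnerFace ![k, j - 1]) :
    (![k, j] : Site 2) ∈ E.zdBoundary ∧ (![k + 1, j] : Site 2) ∈ E.zdBoundary := by
  have hfb : E.IsFaceBoundaryEdge ![k, j] ![k + 1, j] := by
    refine ⟨adj_bottom_of_inner h, ⟨_, h, isCorner_vec_iff.2 (Or.inl rfl), isCorner_vec_iff.2 (Or.inr (Or.inl rfl))⟩,
      ⟨_, h', isCorner_vec_iff.2 (Or.inr (Or.inr (Or.inl (by simp)))),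
        isCorner_vec_iff.2 (Or.inr (Or.inr (Or.inr (by simp))))⟩⟩
  exact hfb.mem_zdBoundary

/-- Both ends of the side between an inner cell `(k, j)` and a non-inner cell `(k, j+1)` above it
are boundary sites. [folklore] -/
theorem mem_zdBoundary_of_inner_not_inner_above {E : DiscreteDobrushin} {k j : ℤ}
    (h : E.IsInnerFace ![k, j]) (h' : ¬ E.IsInnerFace ![k, j + 1]) :
    (![k, j + 1] : Site 2) ∈ E.zdBoundary ∧ (![k + 1, j + 1] : Site 2) ∈ E.zdBoundary := by
  have hfb : E.IsFaceBoundaryEdge ![k, j + 1] ![k + 1, j + 1] := by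
    refine ⟨adj_top_of_inner h, ⟨_, h, isCorner_vec_iff.2 (Or.inr (Or.inr (Or.inl rfl))),
      isCorner_vec_iff.2 (Or.inr (Or.inr (Or.inr rfl)))⟩,
      ⟨_, h', isCorner_vec_iff.2 (Or.inl rfl), isCorner_vec_iff.2 (Or.inr (Or.inl rfl))⟩⟩
  exact hfb.mem_zdBoundary

/-- Both ends of the side between an inner cell `(k, j)` and a non-inner cell `(k-1, j)` to its left
are boundary sites. [folklore] -/
theorem mem_zdBoundary_of_inner_not_inner_left {E : DiscreteDobrushin} {k j : ℤ}
    (h : E.IsInnerFace ![k, j]) (h' : ¬ E.IsInnerFace ![k - 1, j]) :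
    (![k, j] : Site 2) ∈ E.zdBoundary ∧ (![k, j + 1] : Site 2) ∈ E.zdBoundary := by
  have hfb : E.IsFaceBoundaryEdge ![k, j] ![k, j + 1] := by
    refine ⟨adj_left_of_inner h, ⟨_, h, isCorner_vec_iff.2 (Or.inl rfl), isCorner_vec_iff.2 (Or.inr (Or.inr (Or.inl rfl)))⟩,
      ⟨_, h', isCorner_vec_iff.2 (Or.inr (Or.inl (by simp))),
        isCorner_vec_iff.2 (Or.inr (Or.inr (Or.inr (by simp))))⟩⟩
  exact hfb.mem_zdBoundary

/-- Both ends of the side between an inner cell `(k, j)` and a non-inner cell `(k+1, j)` to its right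
are boundary sites. [folklore] -/
theorem mem_zdBoundary_of_inner_not_inner_right {E : DiscreteDobrushin} {k j : ℤ}
    (h : E.IsInnerFace ![k, j]) (h' : ¬ E.IsInnerFace ![k + 1, j]) :
    (![k + 1, j] : Site 2) ∈ E.zdBoundary ∧ (![k + 1, j + 1] : Site 2) ∈ E.zdBoundary := by
  have hfb : E.IsFaceBoundaryEdge ![k + 1, j] ![k + 1, j + 1] := by
    refine ⟨adj_right_of_inner h, ⟨_, h, isCorner_vec_iff.2 (Or.inr (Or.inl rfl)),
      isCorner_vec_iff.2 (Or.inr (Or.inr (Or.inr rfl)))⟩,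
      ⟨_, h', isCorner_vec_iff.2 (Or.inl rfl), isCorner_vec_iff.2 (Or.inr (Or.inr (Or.inl rfl)))⟩⟩
  exact hfb.mem_zdBoundary

/-! ### Boundary points on open sides -/

/-- **A boundary point on an open horizontal lattice segment forbids both adjacent cells to be
inner** (regular `Ω`). [folklore] -/
theorem not_both_inner_of_frontier_h {E : DiscreteDobrushin} (hΩ : IsOpen E.Ω)
    (hJE : frontier E.Ω ⊆ closure (closure E.Ω)ᶜ) (hext : IsConnected (closure E.Ω)ᶜ)
    (hunb : ¬ Bornology.IsBounded (closure E.Ω)ᶜ) (hδ : 0 < E.δ) {k j₀ : ℤ} {z : ℂ}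
    (hz : z ∈ frontier E.Ω) (hre : z.re ∈ Ioo (E.δ * k) (E.δ * (k + 1))) (him : z.im = E.δ * j₀) :
    ¬ (E.IsInnerFace ![k, j₀ - 1] ∧ E.IsInnerFace ![k, j₀]) := by
  rintro ⟨h₁, h₂⟩
  have hzΩ := mem_of_mem_open_side_h hΩ hJE hext hunb hδ h₁ h₂ hre him
  rw [hΩ.frontier_eq] at hz
  exact hz.2 hzΩ

/-- **A boundary point on an open vertical lattice segment forbids both adjacent cells to be
inner** (regular `Ω`). [folklore] -/
theorem not_both_inner_of_frontier_v {E : DiscreteDobrushin} (hΩ : IsOpen E.Ω)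
    (hJE : frontier E.Ω ⊆ closure (closure E.Ω)ᶜ) (hext : IsConnected (closure E.Ω)ᶜ)
    (hunb : ¬ Bornology.IsBounded (closure E.Ω)ᶜ) (hδ : 0 < E.δ) {k₀ j : ℤ} {z : ℂ}
    (hz : z ∈ frontier E.Ω) (hre : z.re = E.δ * k₀) (him : z.im ∈ Ioo (E.δ * j) (E.δ * (j + 1))) :
    ¬ (E.IsInnerFace ![k₀ - 1, j] ∧ E.IsInnerFace ![k₀, j]) := by
  rintro ⟨h₁, h₂⟩
  have hzΩ := mem_of_mem_open_side_v hΩ hJE hext hunb hδ h₁ h₂ hre him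
  rw [hΩ.frontier_eq] at hz
  exact hz.2 hzΩ

/-! ### Feet of degenerate pairs in coordinates -/

/-- The mesh point of `![a, b]`. [folklore] -/
theorem meshPoint_vec' (δ : ℝ) (a b : ℤ) : meshPoint δ ![a, b] = ⟨δ * a, δ * b⟩ := meshPoint_vec δ a b

/-- `![a, b] + cornerUnit 0 = ![a + 1, b]`. [folklore] -/
theorem vec_add_cornerUnit_zero (a b : ℤ) : (![a, b] : Site 2) + cornerUnit 0 = ![a + 1, b] := by
  funext i; fin_cases i <;> simp [cornerUnit]
/-- `![a, b] + cornerUnit 1 = ![a, b + 1]`. [folklore] -/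
theorem vec_add_cornerUnit_one (a b : ℤ) : (![a, b] : Site 2) + cornerUnit 1 = ![a, b + 1] := by
  funext i; fin_cases i <;> simp [cornerUnit]
/-- `![a, b] + cornerUnit 2 = ![a - 1, b]`. [folklore] -/
theorem vec_add_cornerUnit_two (a b : ℤ) : (![a, b] : Site 2) + cornerUnit 2 = ![a - 1, b] := by
  funext i; fin_cases i
  · simp [cornerUnit, sub_eq_add_neg]
  · simp [cornerUnit]
/-- `![a, b] + cornerUnit 3 = ![a, b - 1]`. [folklore] -/
theorem vec_add_cornerUnit_three (a b : ℤ) : (![a, b] : Site 2) + cornerUnit 3 = ![a, b - 1] := by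
  funext i; fin_cases i
  · simp [cornerUnit]
  · simp [cornerUnit, sub_eq_add_neg]

/-- **Feet of an east-degenerate pair.** If the site `![a+1, b]` is degenerate with its west
neighbour `![a, b]` (`δ + r (a+1, b) ≤ r (a, b)`), every nearest boundary point of `δ(a+1, b)`
is `(δ(a+1) + r, δ b)` with `r = r (a+1, b)`. [folklore] -/
theorem foot_east_degenerate {Ω : Set ℂ} {δ : ℝ} (hδ : 0 < δ) (a b : ℤ)
    (h : δ + infDist (meshPoint δ ![a + 1, b]) (frontier Ω) ≤ infDist (meshPoint δ ![a, b]) (frontier Ω))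
    {f : ℂ} (hf : f ∈ frontier Ω)
    (hdist : dist (meshPoint δ ![a + 1, b]) f = infDist (meshPoint δ ![a + 1, b]) (frontier Ω)) :
    f = ⟨δ * (a + 1) + infDist (meshPoint δ ![a + 1, b]) (frontier Ω), δ * b⟩ := by
  rw [← vec_add_cornerUnit_zero] at h hdist ⊢
  rw [foot_eq_farPole hδ _ 0 h hf hdist, vec_add_cornerUnit_zero, meshPoint_vec']
  apply Complex.ext
  · simp [cornerUnit, meshPoint, Site.toComplex]
    field_simp
  · simp [cornerUnit, meshPoint, Site.toComplex]

/-- **Feet of a north-degenerate pair.** If `![a, b+1]` is degenerate with its south neighbour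
`![a, b]`, every nearest boundary point of `δ(a, b+1)` is `(δ a, δ(b+1) + r)`. [folklore] -/
theorem foot_north_degenerate {Ω : Set ℂ} {δ : ℝ} (hδ : 0 < δ) (a b : ℤ)
    (h : δ + infDist (meshPoint δ ![a, b + 1]) (frontier Ω) ≤ infDist (meshPoint δ ![a, b]) (frontier Ω))
    {f : ℂ} (hf : f ∈ frontier Ω)
    (hdist : dist (meshPoint δ ![a, b + 1]) f = infDist (meshPoint δ ![a, b + 1]) (frontier Ω)) :
    f = ⟨δ * a, δ * (b + 1) + infDist (meshPoint δ ![a, b + 1]) (frontier Ω)⟩ := by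
  rw [← vec_add_cornerUnit_one] at h hdist ⊢
  rw [foot_eq_farPole hδ _ 1 h hf hdist, vec_add_cornerUnit_one, meshPoint_vec']
  apply Complex.ext
  · simp [cornerUnit, meshPoint, Site.toComplex]
  · simp [cornerUnit, meshPoint, Site.toComplex]
    field_simp

/-- **Feet of a west-degenerate pair.** If `![a, b]` is degenerate with its east neighbour
`![a+1, b]`, every nearest boundary point of `δ(a, b)` is `(δ a - r, δ b)`. [folklore] -/
theorem foot_west_degenerate {Ω : Set ℂ} {δ : ℝ} (hδ : 0 < δ) (a b : ℤ)
    (h : δ + infDist (meshPoint δ ![a, b]) (frontier Ω) ≤ infDist (meshPoint δ ![a + 1, b]) (frontier Ω))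
    {f : ℂ} (hf : f ∈ frontier Ω)
    (hdist : dist (meshPoint δ ![a, b]) f = infDist (meshPoint δ ![a, b]) (frontier Ω)) :
    f = ⟨δ * a - infDist (meshPoint δ ![a, b]) (frontier Ω), δ * b⟩ := by
  have e2 : (![a + 1, b] : Site 2) + cornerUnit 2 = ![a, b] := by
    rw [vec_add_cornerUnit_two]; simp
  rw [← e2] at h hdist ⊢
  rw [foot_eq_farPole hδ _ 2 h hf hdist, e2, meshPoint_vec']
  apply Complex.ext
  · simp [cornerUnit, meshPoint, Site.toComplex]
    field_simp
    ring
  · simp [cornerUnit, meshPoint, Site.toComplex]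


/-- **Feet of a south-degenerate pair.** If `![a, b]` is degenerate with its north neighbour
`![a, b+1]`, every nearest boundary point of `δ(a, b)` is `(δ a, δ b - r)`. [folklore] -/
theorem foot_south_degenerate {Ω : Set ℂ} {δ : ℝ} (hδ : 0 < δ) (a b : ℤ)
    (h : δ + infDist (meshPoint δ ![a, b]) (frontier Ω) ≤ infDist (meshPoint δ ![a, b + 1]) (frontier Ω))
    {f : ℂ} (hf : f ∈ frontier Ω)
    (hdist : dist (meshPoint δ ![a, b]) f = infDist (meshPoint δ ![a, b]) (frontier Ω)) :
    f = ⟨δ * a, δ * b - infDist (meshPoint δ ![a, b]) (frontier Ω)⟩ := by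
  have e3 : (![a, b + 1] : Site 2) + cornerUnit 3 = ![a, b] := by
    rw [vec_add_cornerUnit_three]; simp
  rw [← e3] at h hdist ⊢
  rw [foot_eq_farPole hδ _ 3 h hf hdist, e3, meshPoint_vec']
  apply Complex.ext
  · simp [cornerUnit, meshPoint, Site.toComplex]
  · simp [cornerUnit, meshPoint, Site.toComplex]
    field_simp
    ring

/-- A site of an east–west pair, the other of which is a boundary site, in a degenerate position
has radius `< δ` (indeed `< δ/2`); packaged with positivity for a boundary site. [folklore] -/
theorem infDist_pos_lt_of_degenerate {E : DiscreteDobrushin} (hΩ : IsOpen E.Ω) (hδ : 0 < E.δ)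
    {u : Site 2} (hu : u ∈ E.zdBoundary) (m : Fin 4) (hv : u + cornerUnit m ∈ E.zdBoundary)
    (h : E.δ + infDist (meshPoint E.δ (u + cornerUnit m)) (frontier E.Ω) ≤
      infDist (meshPoint E.δ u) (frontier E.Ω)) :
    0 < infDist (meshPoint E.δ (u + cornerUnit m)) (frontier E.Ω) ∧
      infDist (meshPoint E.δ (u + cornerUnit m)) (frontier E.Ω) < E.δ :=
  ⟨infDist_frontier_pos hΩ hδ hv, (infDist_lt_half_of_degenerate hΩ hδ hu m h).trans (by linarith)⟩

end Summit.CriticalPhenomena.CardyFormulaZ2.Theorems.DiscretisationFamilyExists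

end
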